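import Mathlib
import Literature.NumberTheory.Transcendental.KZCubeRationalMoves
import Literature.NumberTheory.Transcendental.KZSemialgebraicComplex
import Literature.NumberTheory.Transcendental.SemialgebraicMapsProofs

/-!
# `TateFamilyKernel` toolkit — Ayoub's relation `relA` for TAME data (analytic + `ℚ`-semialgebraic)

Crux `TateFamilyKernel` (stmt-KontsevichZagierPeriods-9130, route `InverseLandau`). Every certificate
line for the crux (cards rational-cube-certificates, telescoper-wall-crossing, DlogLoop-type loop
relators with parameters) writes the fibre at a real-ALGEBRAIC parameter `ϖ₀` as a sum of Ayoub
generators `relA_i(G) = ∂ᵢG − G|_{xᵢ=1} + G|_{xᵢ=0}` whose data `G` are rational in the cube variables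
with coefficients in `ℚ(ϖ₀)` — regular near the closed cube and `ℚ`-semialgebraic, but NOT
`ℚ`-rational, so the `KZ.RFun` engine (`KZCubeRationalMoves.lean`, `ℚ`-coefficients) does not apply
literally. This file redoes the three moves of that engine for abstract TAME data (integrands analytic
near `[0,1]^N` and `ℚ`-semialgebraic on it, `KZ.IntegralRep.IsTameCube`):

* `tame_stokesAt` — `[∂ᵢG] ≡ [G|_{xᵢ=1}] − [G|_{xᵢ=0}]` along ANY coordinate `i` (reindex to the last
  coordinate, `KZ.of_sub_of_reindex_mem_relations`, then `KZ.cubicalStokesGens`);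
* `tame_liftAt` — ignoring a coordinate: `[[0,1]^{N+1}, u ∘ removeNth i] ≡ [[0,1]^N, u]`;
* `tame_relA_mem_relations` — the Ayoub element `[[0,1]^{N+1}, ∂ᵢG − G|₁ ∘ removeNth i + G|₀ ∘ removeNth i]`
  is a relation.

All hypotheses are the honest ones of the cubical calculus; no named fact, no new definition.
References: Kontsevich–Zagier 2001 §1.2 rules (1)–(3); Ayoub, EMS Newsl. 91 (2014), Def. 10.
-/

noncomputable section

open MeasureTheory Set MvPolynomial
open Literature.NumberTheory.Transcendental
open Literature.ModelTheory.ExponentialFields (IsSemialgebraic)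

namespace Summit.KontsevichZagierPeriods.InverseLandau.TateFamilyKernel

variable {N : ℕ}

/-! ### Cube membership under coordinate operations -/

/-- Relabelling coordinates preserves the cube. [folklore] -/
theorem setOf_comp_equiv_mem_cube (e : Fin N ≃ Fin N) :
    {w : Fin N → ℝ | (fun j => w (e j)) ∈ KZ.cube N} = KZ.cube N := by
  ext w
  simp only [mem_setOf_eq, KZ.mem_cube]
  exact ⟨fun h j => by simpa using h (e.symm j), fun h j => h (e j)⟩

/-- Inserting a coordinate in `[0,1]` keeps a point of `[0,1]^N` in `[0,1]^{N+1}`. [folklore] -/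
theorem insertNth_mem_cube (i : Fin (N + 1)) {c : ℝ} (hc : c ∈ Icc (0 : ℝ) 1) {x : Fin N → ℝ}
    (hx : x ∈ KZ.cube N) : (Fin.insertNth i c x : Fin (N + 1) → ℝ) ∈ KZ.cube (N + 1) := by
  intro j
  induction j using Fin.succAboveCases i with
  | x => simpa [Fin.insertNth_apply_same] using hc
  | p k => simpa [Fin.insertNth_apply_succAbove] using KZ.mem_cube.1 hx k

/-- Removing a coordinate keeps a point of `[0,1]^{N+1}` in `[0,1]^N`. [folklore] -/
theorem removeNth_mem_cube (i : Fin (N + 1)) {w : Fin (N + 1) → ℝ} (hw : w ∈ KZ.cube (N + 1)) :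
    Fin.removeNth i w ∈ KZ.cube N := fun k => KZ.mem_cube.1 hw (i.succAbove k)

/-! ### Analyticity of the coordinate operations -/

/-- Relabelling coordinates is a continuous linear map. [folklore] -/
theorem exists_clm_comp_equiv (e : Fin N ≃ Fin N) :
    ∃ L : (Fin N → ℝ) →L[ℝ] (Fin N → ℝ), ∀ w, L w = fun j => w (e j) :=
  ⟨ContinuousLinearMap.pi fun j => ContinuousLinearMap.proj (e j), fun w => by ext j; simp⟩

/-- Removing a coordinate is a continuous linear map. [folklore] -/
theorem exists_clm_removeNth (i : Fin (N + 1)) :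
    ∃ L : (Fin (N + 1) → ℝ) →L[ℝ] (Fin N → ℝ), ∀ w, L w = Fin.removeNth i w :=
  ⟨ContinuousLinearMap.pi fun k => ContinuousLinearMap.proj (i.succAbove k), fun w => by
    ext k; simp [Fin.removeNth]⟩

/-- Inserting a fixed coordinate is an affine map. [folklore] -/
theorem exists_clm_insertNth (i : Fin (N + 1)) (c : ℝ) :
    ∃ L : (Fin N → ℝ) →L[ℝ] (Fin (N + 1) → ℝ), ∀ x,
      (Fin.insertNth i c x : Fin (N + 1) → ℝ) = L x + Fin.insertNth i c (0 : Fin N → ℝ) := by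
  refine ⟨ContinuousLinearMap.pi fun j =>
    Fin.insertNth (α := fun _ => (Fin N → ℝ) →L[ℝ] ℝ) i 0 (fun k => ContinuousLinearMap.proj k) j,
    fun x => ?_⟩
  ext j
  induction j using Fin.succAboveCases i with
  | x => simp [Fin.insertNth_apply_same]
  | p k => simp [Fin.insertNth_apply_succAbove]

/-- A function analytic near the cube stays analytic near the cube after relabelling coordinates.
[folklore] -/
theorem analyticOnNhd_comp_equiv {G : (Fin N → ℝ) → ℝ} (hG : AnalyticOnNhd ℝ G (KZ.cube N))
    (e : Fin N ≃ Fin N) : AnalyticOnNhd ℝ (fun w => G (fun j => w (e j))) (KZ.cube N) := by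
  obtain ⟨L, hL⟩ := exists_clm_comp_equiv e
  intro w hw
  have hwe : (fun j => w (e j)) ∈ KZ.cube N := by
    rw [← setOf_comp_equiv_mem_cube e] at hw; exact hw
  have hGL : AnalyticAt ℝ G (L w) := by rw [hL]; exact hG _ hwe
  have h := hGL.comp (L.analyticAt w)
  refine h.congr (Filter.Eventually.of_forall fun v => ?_)
  simp [hL]

/-- A function analytic near `[0,1]^{N+1}` has faces analytic near `[0,1]^N`. [folklore] -/
theorem analyticOnNhd_comp_insertNth {G : (Fin (N + 1) → ℝ) → ℝ}
    (hG : AnalyticOnNhd ℝ G (KZ.cube (N + 1))) (i : Fin (N + 1)) {c : ℝ} (hc : c ∈ Icc (0 : ℝ) 1) :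
    AnalyticOnNhd ℝ (fun x : Fin N → ℝ => G (Fin.insertNth i c x)) (KZ.cube N) := by
  obtain ⟨L, hL⟩ := exists_clm_insertNth (N := N) i c
  intro x hx
  have hι : AnalyticAt ℝ (fun x : Fin N → ℝ => (Fin.insertNth i c x : Fin (N + 1) → ℝ)) x := by
    have : (fun x : Fin N → ℝ => (Fin.insertNth i c x : Fin (N + 1) → ℝ)) =
        fun x => L x + Fin.insertNth i c (0 : Fin N → ℝ) := funext hL
    rw [this]
    exact (L.analyticAt x).add analyticAt_const
  exact (hG _ (insertNth_mem_cube i hc hx)).comp hι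

/-- A function analytic near `[0,1]^N`, read on `[0,1]^{N+1}` by ignoring coordinate `i`, is analytic
near `[0,1]^{N+1}`. [folklore] -/
theorem analyticOnNhd_comp_removeNth {u : (Fin N → ℝ) → ℝ} (hu : AnalyticOnNhd ℝ u (KZ.cube N))
    (i : Fin (N + 1)) : AnalyticOnNhd ℝ (fun w : Fin (N + 1) → ℝ => u (Fin.removeNth i w)) (KZ.cube (N + 1)) := by
  obtain ⟨L, hL⟩ := exists_clm_removeNth (N := N) i
  intro w hw
  have huL : AnalyticAt ℝ u (L w) := by rw [hL]; exact hu _ (removeNth_mem_cube i hw)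
  have h := huL.comp (L.analyticAt w)
  refine h.congr (Filter.Eventually.of_forall fun v => ?_)
  simp [hL]

/-! ### Semialgebraicity of the coordinate operations -/

/-- Inserting a rational coordinate is a `ℚ`-semialgebraic map. [cite: BochnakCosteRoy1998, §2.2] -/
theorem isSemialgebraicMapOn_insertNth {s : Set (Fin N → ℝ)} (hs : IsSemialgebraic ℚ s)
    (i : Fin (N + 1)) (c : ℚ) :
    IsSemialgebraicMapOn ℚ s (fun x : Fin N → ℝ => (Fin.insertNth i (c : ℝ) x : Fin (N + 1) → ℝ)) := by
  refine IsSemialgebraicMapOn.of_forall hs fun j => ?_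
  induction j using Fin.succAboveCases i with
  | x => simpa [Fin.insertNth_apply_same] using isSemialgebraicFunOn_ratCast hs c
  | p k => simpa [Fin.insertNth_apply_succAbove] using isSemialgebraicFunOn_apply hs k

/-- Removing a coordinate is a `ℚ`-semialgebraic map. [cite: BochnakCosteRoy1998, §2.2] -/
theorem isSemialgebraicMapOn_removeNth {s : Set (Fin (N + 1) → ℝ)} (hs : IsSemialgebraic ℚ s)
    (i : Fin (N + 1)) : IsSemialgebraicMapOn ℚ s (fun w : Fin (N + 1) → ℝ => Fin.removeNth i w) :=
  IsSemialgebraicMapOn.of_forall hs fun k => by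
    simpa [Fin.removeNth] using isSemialgebraicFunOn_apply hs (i.succAbove k)

/-- Faces of a `ℚ`-semialgebraic function on `[0,1]^{N+1}` are `ℚ`-semialgebraic on `[0,1]^N`.
[cite: BochnakCosteRoy1998, Prop. 2.2.6] -/
theorem isSemialgebraicFunOn_comp_insertNth {G : (Fin (N + 1) → ℝ) → ℝ}
    (hG : IsSemialgebraicFunOn ℚ (KZ.cube (N + 1)) G) (i : Fin (N + 1)) {c : ℚ}
    (hc : (c : ℝ) ∈ Icc (0 : ℝ) 1) :
    IsSemialgebraicFunOn ℚ (KZ.cube N) (fun x : Fin N → ℝ => G (Fin.insertNth i (c : ℝ) x)) :=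
  IsSemialgebraicFunOn.comp_isSemialgebraicMapOn_holds hG
    (isSemialgebraicMapOn_insertNth KZ.isSemialgebraic_cube i c) fun _ hx => insertNth_mem_cube i hc hx

/-- A `ℚ`-semialgebraic function on `[0,1]^N`, read on `[0,1]^{N+1}` by ignoring a coordinate, is
`ℚ`-semialgebraic. [cite: BochnakCosteRoy1998, Prop. 2.2.6] -/
theorem isSemialgebraicFunOn_comp_removeNth {u : (Fin N → ℝ) → ℝ}
    (hu : IsSemialgebraicFunOn ℚ (KZ.cube N) u) (i : Fin (N + 1)) :
    IsSemialgebraicFunOn ℚ (KZ.cube (N + 1)) (fun w : Fin (N + 1) → ℝ => u (Fin.removeNth i w)) :=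
  IsSemialgebraicFunOn.comp_isSemialgebraicMapOn_holds hu
    (isSemialgebraicMapOn_removeNth KZ.isSemialgebraic_cube i) fun _ hw => removeNth_mem_cube i hw

/-- Relabelling coordinates of a `ℚ`-semialgebraic function on the cube. [cite: BochnakCosteRoy1998, §2.2] -/
theorem isSemialgebraicFunOn_comp_equiv {G : (Fin N → ℝ) → ℝ}
    (hG : IsSemialgebraicFunOn ℚ (KZ.cube N) G) (e : Fin N ≃ Fin N) :
    IsSemialgebraicFunOn ℚ (KZ.cube N) (fun w => G (fun j => w (e j))) := by
  have h := hG.comp_equiv e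
  rwa [setOf_comp_equiv_mem_cube] at h

/-! ### Tame representations of the derived data exist -/

/-- A face of a tame integrand carries a tame cube representation. [cite: Ayoub2014, Def. 10] -/
theorem exists_isTameCube_face {G : (Fin (N + 1) → ℝ) → ℝ} (hGa : AnalyticOnNhd ℝ G (KZ.cube (N + 1)))
    (hGs : IsSemialgebraicFunOn ℚ (KZ.cube (N + 1)) G) (i : Fin (N + 1)) {c : ℚ}
    (hc : (c : ℝ) ∈ Icc (0 : ℝ) 1) :
    ∃ F : KZ.IntegralRep N, F.IsTameCube ∧ F.integrand = fun x => G (Fin.insertNth i (c : ℝ) x) :=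
  ⟨KZ.IntegralRep.tameCube _ (analyticOnNhd_comp_insertNth hGa i hc) (isSemialgebraicFunOn_comp_insertNth hGs i hc),
    KZ.IntegralRep.isTameCube_tameCube _ _ _, rfl⟩

/-- A tame integrand read in one more (ignored) coordinate carries a tame cube representation.
[cite: Ayoub2014, Def. 10] -/
theorem exists_isTameCube_lift {u : (Fin N → ℝ) → ℝ} (hua : AnalyticOnNhd ℝ u (KZ.cube N))
    (hus : IsSemialgebraicFunOn ℚ (KZ.cube N) u) (i : Fin (N + 1)) :
    ∃ U : KZ.IntegralRep (N + 1), U.IsTameCube ∧ U.integrand = fun w => u (Fin.removeNth i w) :=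
  ⟨KZ.IntegralRep.tameCube _ (analyticOnNhd_comp_removeNth hua i) (isSemialgebraicFunOn_comp_removeNth hus i),
    KZ.IntegralRep.isTameCube_tameCube _ _ _, rfl⟩

/-! ### Stokes along any coordinate, for tame data -/

/-- Reading a `snoc` point along `toLast i` inserts the last coordinate at `i` (the tree's
`KZ.RFun.snoc_comp_toLast`, pointwise). [folklore] -/
theorem snoc_apply_toLast (i : Fin (N + 1)) (x : Fin N → ℝ) (c : ℝ) :
    (fun j => (Fin.snoc x c : Fin (N + 1) → ℝ) (KZ.RFun.toLast i j)) = Fin.insertNth i c x := by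
  have h := KZ.RFun.snoc_comp_toLast i x c
  exact h

/-- **Stokes along any coordinate for tame data**: if `R = [[0,1]^{N+1}, G']` with `G` analytic near
the cube, `ℚ`-semialgebraic on it and `∂ᵢG = G'` on the cube (as the derivative of
`s ↦ G(w with wᵢ := s)` at `s = wᵢ`), and `F₁ = [[0,1]^N, G|_{xᵢ=1}]`, `F₀ = [[0,1]^N, G|_{xᵢ=0}]`
are tame, then `[R] − ([F₁] − [F₀]) ∈ KZ.relations`. Proof: relabel `i` to the last coordinate
(rule (2), `KZ.of_sub_of_reindex_mem_relations`), one cubical Stokes move along the last coordinate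
(rule (3), `KZ.cubicalStokesGens`), linearity (rule (1)).
[cite: KontsevichZagier2001, §1.2] [cite: Ayoub2014, Def. 10] -/
theorem tame_stokesAt (i : Fin (N + 1)) {G G' : (Fin (N + 1) → ℝ) → ℝ}
    (hGa : AnalyticOnNhd ℝ G (KZ.cube (N + 1))) (hGs : IsSemialgebraicFunOn ℚ (KZ.cube (N + 1)) G)
    (hder : ∀ w ∈ KZ.cube (N + 1), HasDerivAt (fun s : ℝ => G (Function.update w i s)) (G' w) (w i))
    (R : KZ.IntegralRep (N + 1)) (hR : R.IsTameCube) (hRi : ∀ w ∈ KZ.cube (N + 1), R.integrand w = G' w)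
    (F1 F0 : KZ.IntegralRep N) (hF1 : F1.IsTameCube) (hF0 : F0.IsTameCube)
    (hF1i : ∀ x ∈ KZ.cube N, F1.integrand x = G (Fin.insertNth i 1 x))
    (hF0i : ∀ x ∈ KZ.cube N, F0.integrand x = G (Fin.insertNth i 0 x)) :
    KZ.of R - (KZ.of F1 - KZ.of F0) ∈ KZ.relations := by
  set e : Fin (N + 1) ≃ Fin (N + 1) := KZ.RFun.toLast i with he
  -- (a) relabel `R` so that `i` becomes the last coordinate
  have h1 : KZ.of R - KZ.of (R.reindex e) ∈ KZ.relations := KZ.of_sub_of_reindex_mem_relations R e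
  -- the relabelled integrand as a tame cube
  set Rt : KZ.IntegralRep (N + 1) := KZ.IntegralRep.tameCube (fun w => R.integrand (fun j => w (e j)))
    (analyticOnNhd_comp_equiv hR.analyticOnNhd e) (isSemialgebraicFunOn_comp_equiv hR.isSemialgebraicFunOn e)
    with hRt
  have h2 : KZ.of (R.reindex e) - KZ.of Rt ∈ KZ.relations := by
    refine KZ.of_sub_of_mem_relations_of_eqOn ?_ fun w _ => ?_
    · rw [hRt, KZ.IntegralRep.tameCube_domain, KZ.IntegralRep.reindex_domain, hR.domain_eq,
        setOf_comp_equiv_mem_cube]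
    · simp [hRt]
  -- (b) Stokes along the last coordinate for `Gt w = G (w ∘ e)`
  set Gt : (Fin (N + 1) → ℝ) → ℝ := fun w => G (fun j => w (e j)) with hGt
  obtain ⟨D, hD, hDi⟩ : ∃ D : KZ.IntegralRep N, D.IsTameCube ∧
      D.integrand = fun x => G (Fin.insertNth i 1 x) - G (Fin.insertNth i 0 x) := by
    have h1c : ((1 : ℚ) : ℝ) ∈ Icc (0 : ℝ) 1 := by norm_num
    have h0c : ((0 : ℚ) : ℝ) ∈ Icc (0 : ℝ) 1 := by norm_num
    have ha : AnalyticOnNhd ℝ (fun x : Fin N → ℝ => G (Fin.insertNth i 1 x) - G (Fin.insertNth i 0 x))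
        (KZ.cube N) := fun x hx => by
      have ha1 := analyticOnNhd_comp_insertNth hGa i (c := 1) ⟨zero_le_one, le_rfl⟩ x hx
      have ha0 := analyticOnNhd_comp_insertNth hGa i (c := 0) ⟨le_rfl, zero_le_one⟩ x hx
      exact ha1.sub ha0
    have hs : IsSemialgebraicFunOn ℚ (KZ.cube N)
        (fun x : Fin N → ℝ => G (Fin.insertNth i 1 x) - G (Fin.insertNth i 0 x)) := by
      have hs1 := isSemialgebraicFunOn_comp_insertNth hGs i (c := 1) h1c
      have hs0 := isSemialgebraicFunOn_comp_insertNth hGs i (c := 0) h0c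
      simp only [Rat.cast_one, Rat.cast_zero] at hs1 hs0
      exact IsSemialgebraicFunOn.sub_holds hs1 hs0
    exact ⟨KZ.IntegralRep.tameCube _ ha hs, KZ.IntegralRep.isTameCube_tameCube _ _ _, rfl⟩
  have h3 : KZ.of Rt - KZ.of D ∈ KZ.relations := by
    refine KZ.cubicalStokesGens_subset_relations (KZ.mem_cubicalStokesGens (F := Gt)
      (KZ.IntegralRep.isTameCube_tameCube _ _ _) hD (analyticOnNhd_comp_equiv hGa e)
      (isSemialgebraicFunOn_comp_equiv hGs e) (fun x hx t ht => ?_) (fun x hx => ?_))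
    · -- the derivative along the last coordinate of `Gt` is the `i`-th partial of `G`
      have hw : (Fin.insertNth i t x : Fin (N + 1) → ℝ) ∈ KZ.cube (N + 1) := insertNth_mem_cube i ht hx
      have hd := hder _ hw
      simp only [Fin.insertNth_apply_same, Fin.update_insertNth] at hd
      have hfun : (fun s : ℝ => Gt (Fin.snoc x s)) = fun s => G (Fin.insertNth i s x) := by
        funext s
        simp only [hGt]
        rw [snoc_apply_toLast]
      rw [hfun]
      have hval : Rt.integrand (Fin.snoc x t) = G' (Fin.insertNth i t x) := by
        simp only [hRt, KZ.IntegralRep.tameCube_integrand]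
        rw [snoc_apply_toLast, hRi _ hw]
      rw [hval]
      exact hd
    · rw [hDi]
      simp only [hGt]
      rw [snoc_apply_toLast, snoc_apply_toLast]
  -- (c) split the face difference
  have h4 : KZ.of F1 - KZ.of D - KZ.of F0 ∈ KZ.relations :=
    KZ.cubicalLinGens_subset_relations (KZ.mem_cubicalLinGens hF1 hD hF0 fun x hx => by
      simp only [Pi.add_apply, hDi, hF1i x hx, hF0i x hx, sub_add_cancel])
  have : KZ.of R - (KZ.of F1 - KZ.of F0) =
      (KZ.of R - KZ.of (R.reindex e)) + (KZ.of (R.reindex e) - KZ.of Rt) + (KZ.of Rt - KZ.of D) -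
        (KZ.of F1 - KZ.of D - KZ.of F0) := by abel
  rw [this]
  exact KZ.relations.sub_mem (KZ.relations.add_mem (KZ.relations.add_mem h1 h2) h3) h4

/-- **Ignoring a coordinate is a relation, for tame data**: if `U = [[0,1]^{N+1}, u ∘ removeNth i]`
and `u₀ = [[0,1]^N, u]` are tame then `[U] − [u₀] ∈ KZ.relations` (Stokes along `i` with the primitive
`wᵢ · u(removeNth i w)`, whose faces are `u` and `0`). [cite: KontsevichZagier2001, §1.2 rule (3)] -/
theorem tame_liftAt (i : Fin (N + 1)) {u : (Fin N → ℝ) → ℝ} (hua : AnalyticOnNhd ℝ u (KZ.cube N))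
    (hus : IsSemialgebraicFunOn ℚ (KZ.cube N) u)
    (U : KZ.IntegralRep (N + 1)) (hU : U.IsTameCube)
    (hUi : ∀ w ∈ KZ.cube (N + 1), U.integrand w = u (Fin.removeNth i w))
    (u0 : KZ.IntegralRep N) (hu0 : u0.IsTameCube) (hu0i : ∀ x ∈ KZ.cube N, u0.integrand x = u x) :
    KZ.of U - KZ.of u0 ∈ KZ.relations := by
  -- the primitive `G w = w i * u (removeNth i w)`
  set G : (Fin (N + 1) → ℝ) → ℝ := fun w => w i * u (Fin.removeNth i w) with hG
  have hGa : AnalyticOnNhd ℝ G (KZ.cube (N + 1)) := fun w hw =>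
    ((ContinuousLinearMap.proj (R := ℝ) (φ := fun _ : Fin (N + 1) => ℝ) i).analyticAt w).mul
      (analyticOnNhd_comp_removeNth hua i w hw)
  have hGs : IsSemialgebraicFunOn ℚ (KZ.cube (N + 1)) G :=
    IsSemialgebraicFunOn.mul_holds (isSemialgebraicFunOn_apply KZ.isSemialgebraic_cube i)
      (isSemialgebraicFunOn_comp_removeNth hus i)
  have hder : ∀ w ∈ KZ.cube (N + 1),
      HasDerivAt (fun s : ℝ => G (Function.update w i s)) (u (Fin.removeNth i w)) (w i) := by
    intro w _
    have hfun : (fun s : ℝ => G (Function.update w i s)) = fun s => s * u (Fin.removeNth i w) := by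
      funext s
      simp only [hG, Function.update_self, Fin.removeNth_update]
    rw [hfun]
    simpa using (hasDerivAt_id (w i)).mul_const (u (Fin.removeNth i w))
  -- the zero face
  obtain ⟨Z, hZd, hZi⟩ := KZ.exists_zeroRep (KZ.isSemialgebraic_cube (n := N))
  have hZ : Z.IsTameCube := ⟨hZd, by rw [hZi]; exact analyticOnNhd_const⟩
  have hst := tame_stokesAt i hGa hGs hder U hU (fun w hw => by rw [hUi w hw]) u0 Z hu0 hZ
    (fun x hx => by simp [hG, hu0i x hx, Fin.insertNth_apply_same, Fin.removeNth_insertNth])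
    (fun x _ => by simp [hG, hZi, Fin.insertNth_apply_same])
  have hZrel : KZ.of Z ∈ KZ.relations := KZ.of_mem_relations_of_eqOn_zero Z (by simp [hZi, EqOn])
  have : KZ.of U - KZ.of u0 = (KZ.of U - (KZ.of u0 - KZ.of Z)) - KZ.of Z := by abel
  rw [this]
  exact KZ.relations.sub_mem hst hZrel

/-- **Ayoub's relation for tame data**: with `G, G'` as in `tame_stokesAt`, every tame cube
representation `A` of the function `w ↦ G' w − G(w|_{wᵢ=1}) + G(w|_{wᵢ=0})` (the faces read in
`N + 1` variables by ignoring `wᵢ`) lies in `KZ.relations`: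
`[A] = [∂ᵢG] − [G|₁ ∘ removeNth i] + [G|₀ ∘ removeNth i] ≡ ([G|₁] − [G|₀]) − [G|₁] + [G|₀] = 0`.
[cite: Ayoub2014, Def. 10] [cite: KontsevichZagier2001, §1.2] -/
theorem tame_relA_mem_relations (i : Fin (N + 1)) {G G' : (Fin (N + 1) → ℝ) → ℝ}
    (hGa : AnalyticOnNhd ℝ G (KZ.cube (N + 1))) (hGs : IsSemialgebraicFunOn ℚ (KZ.cube (N + 1)) G)
    (hG'a : AnalyticOnNhd ℝ G' (KZ.cube (N + 1))) (hG's : IsSemialgebraicFunOn ℚ (KZ.cube (N + 1)) G')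
    (hder : ∀ w ∈ KZ.cube (N + 1), HasDerivAt (fun s : ℝ => G (Function.update w i s)) (G' w) (w i))
    (A : KZ.IntegralRep (N + 1)) (hA : A.IsTameCube)
    (hAi : ∀ w ∈ KZ.cube (N + 1), A.integrand w =
      G' w - G (Function.update w i 1) + G (Function.update w i 0)) :
    KZ.of A ∈ KZ.relations := by
  have h1c : ((1 : ℚ) : ℝ) ∈ Icc (0 : ℝ) 1 := by norm_num
  have h0c : ((0 : ℚ) : ℝ) ∈ Icc (0 : ℝ) 1 := by norm_num
  -- tame representations of `G'`, of the two faces, and of the two lifted faces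
  set R : KZ.IntegralRep (N + 1) := KZ.IntegralRep.tameCube G' hG'a hG's with hR
  obtain ⟨F1, hF1, hF1i⟩ := exists_isTameCube_face hGa hGs i (c := 1) h1c
  obtain ⟨F0, hF0, hF0i⟩ := exists_isTameCube_face hGa hGs i (c := 0) h0c
  simp only [Rat.cast_one] at hF1i
  simp only [Rat.cast_zero] at hF0i
  obtain ⟨U1, hU1, hU1i⟩ := exists_isTameCube_lift (analyticOnNhd_comp_insertNth hGa i ⟨zero_le_one, le_rfl⟩)
    (by simpa using isSemialgebraicFunOn_comp_insertNth hGs i (c := 1) h1c) i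
  obtain ⟨U0, hU0, hU0i⟩ := exists_isTameCube_lift (analyticOnNhd_comp_insertNth hGa i ⟨le_rfl, zero_le_one⟩)
    (by simpa using isSemialgebraicFunOn_comp_insertNth hGs i (c := 0) h0c) i
  -- the three moves
  have hst : KZ.of R - (KZ.of F1 - KZ.of F0) ∈ KZ.relations :=
    tame_stokesAt i hGa hGs hder R (KZ.IntegralRep.isTameCube_tameCube _ _ _) (fun w _ => by simp [hR])
      F1 F0 hF1 hF0 (fun x _ => by rw [hF1i]) (fun x _ => by rw [hF0i])
  have hl1 : KZ.of U1 - KZ.of F1 ∈ KZ.relations :=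
    tame_liftAt i (analyticOnNhd_comp_insertNth hGa i ⟨zero_le_one, le_rfl⟩)
      (by simpa using isSemialgebraicFunOn_comp_insertNth hGs i (c := 1) h1c)
      U1 hU1 (fun w _ => by rw [hU1i]) F1 hF1 (fun x _ => by rw [hF1i])
  have hl0 : KZ.of U0 - KZ.of F0 ∈ KZ.relations :=
    tame_liftAt i (analyticOnNhd_comp_insertNth hGa i ⟨le_rfl, zero_le_one⟩)
      (by simpa using isSemialgebraicFunOn_comp_insertNth hGs i (c := 0) h0c)
      U0 hU0 (fun w _ => by rw [hU0i]) F0 hF0 (fun x _ => by rw [hF0i])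
  -- linearity: `A = R − U1 + U0` on the cube, in two steps `A + U1 = R + U0`
  obtain ⟨S, hS, hSi⟩ : ∃ S : KZ.IntegralRep (N + 1), S.IsTameCube ∧ S.integrand = fun w => G' w + G (Fin.insertNth i 0 (Fin.removeNth i w)) := by
    have ha : AnalyticOnNhd ℝ (fun w => G' w + G (Fin.insertNth i 0 (Fin.removeNth i w))) (KZ.cube (N + 1)) :=
      fun w hw => (hG'a w hw).add (analyticOnNhd_comp_removeNth
        (analyticOnNhd_comp_insertNth hGa i ⟨le_rfl, zero_le_one⟩) i w hw)
    have hs : IsSemialgebraicFunOn ℚ (KZ.cube (N + 1)) (fun w => G' w + G (Fin.insertNth i 0 (Fin.removeNth i w))) :=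
      IsSemialgebraicFunOn.add_holds hG's (isSemialgebraicFunOn_comp_removeNth
        (by simpa using isSemialgebraicFunOn_comp_insertNth hGs i (c := 0) h0c) i)
    exact ⟨KZ.IntegralRep.tameCube _ ha hs, KZ.IntegralRep.isTameCube_tameCube _ _ _, rfl⟩
  -- `S = R + U0` and `S = A + U1`
  have hlinS1 : KZ.of S - KZ.of R - KZ.of U0 ∈ KZ.relations :=
    KZ.cubicalLinGens_subset_relations (KZ.mem_cubicalLinGens hS (KZ.IntegralRep.isTameCube_tameCube _ _ _) hU0
      fun w _ => by simp [hSi, hR, hU0i])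
  have hlinS2 : KZ.of S - KZ.of A - KZ.of U1 ∈ KZ.relations :=
    KZ.cubicalLinGens_subset_relations (KZ.mem_cubicalLinGens hS hA hU1 fun w hw => by
      simp only [hSi, Pi.add_apply, hAi w hw, hU1i, Fin.insertNth_removeNth]
      ring)
  have : KZ.of A = (KZ.of S - KZ.of R - KZ.of U0) - (KZ.of S - KZ.of A - KZ.of U1)
      + (KZ.of R - (KZ.of F1 - KZ.of F0)) - (KZ.of U1 - KZ.of F1) + (KZ.of U0 - KZ.of F0) := by abel
  rw [this]
  exact KZ.relations.add_mem (KZ.relations.sub_mem (KZ.relations.add_mem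
    (KZ.relations.sub_mem hlinS1 hlinS2) hst) hl1) hl0

end Summit.KontsevichZagierPeriods.InverseLandau.TateFamilyKernel
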